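import Literature.MathematicalPhysics.QuantumFieldTheory.Balaban1983to89.B12CondIIIJConcrete
import Literature.MathematicalPhysics.QuantumFieldTheory.Balaban1983to89.B12Eq311Models
import Literature.MathematicalPhysics.QuantumFieldTheory.Balaban1983to89.B12Eq44Analytic

/-!
# `Balaban1983to89.B12CondIIIJConcreteModels` — T. Bałaban, *Renormalization group approach to lattice gauge field theories. I*,
Commun. Math. Phys. **109** (1987) 249–301 [Balaban1987RG1], §3 pp. 277–280: the J-half of condition (iii) for the Lemma-4 configuration
DERIVED on the concrete current (`B12CondIIIJConcrete`, p07 gen 8) **in the two models of the tree, for the special case (3.36) (B′ = 0),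
and the analyticity clause of Lemma 4 by composition** — the `U(N)`-type model `B12RegularSpaces111Unitary.unitaryModel` (p. 251
«G … ⊂ U(N)»; `π` = the identity, `Cπ = 1`) and the `SU(N)` model `B12RegularSpaces111SpecialUnitary.suModel` (p. 252 «G is semisimple»;
`π = B12Lemma4Models.slProj N`, `Cπ = 2` by `B12Eq311Models.norm_slProj_le`), exactly as `B12Lemma4CondIVModels` (gen 6) / `B12Eq311Models`
(gen 7) instantiate their parents.

HONEST FRAMING (cell `lit-balaban`, verbatim): statement-level skeleton of published theorems with citation tags; proofs where landed; nothing here is a claim about the Yang–Mills mass gap.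

PDF held: `paper:balaban1987-cmp109-rg-i-small-field` (journal page = PDF page + 248).  THE PRINT, verbatim: p. 277 *«We have to prove that
(U_j(□₀, exp iτB), J_j(□₀, exp iτB))|_X ∈ U^c_j(X, α₀, α₁) (3.36) for all 𝐔, 𝐉, 𝐀 in the above spaces, and for the parameters τ in
the interval [0, 1].»*; p. 279 *«The second inequality in this condition is obtained in the same way. We start with (3.42) and we use
again the formulas and the bounds (1.43)–(1.54) [14].»*; p. 280, Lemma 4: *«… (3.53) for α₀, α₁, α₂, α₃ sufficiently small and satisfying
all the restrictions. The functions in (3.53) are analytic on the above spaces.»*; p. 276 *«these gauge transformations are explicitly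
given analytic functions of 𝐔, depending on 𝐔 restricted to the cube □₀.»*

WHAT THIS MODULE PROVES (theorems only; no `def`, no new `Prop`, no new fact; axioms standard).
§1 `π = id` (`Cπ = 1`): `norm_current_lt_alpha0_id`; `ofBackground_mem_space'_lemma4_of_jInputs_unitary` (𝓜 = `unitaryModel 𝔸`; model
   hypotheses `heGc`, `hπ`, `hgc`, `hπR`, `hπn` and the `𝔤ᶜ`-valuedness of `𝐊`, `𝐀₂` discharged as in `B12Lemma4CondIVModels`).
§2 `π = slProj N` (`Cπ = 2`, operator norms on `M_N(ℂ)`, `N ≠ 0` for `‖1‖ = 1`): `norm_current_lt_alpha0_su`;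
   `ofBackground_mem_space'_lemma4_of_jInputs_su` (𝓜 = `suModel N`; `𝐊`, `𝐀₂` traceless).
§3 (3.36) = the case `B′ = 0` of (3.53): `norm_current_lt_alpha0_eq336` — `|𝐉(exp iξ𝐇_j(□₀, τQ(…)))(b)| < α₀` from the printed (3.42),
   (J2)×2 and the (3.37) sizes alone (`𝐀₂ = 0`, no (J3), no «2B₃α₃ ≤ …» used beyond the typed list).
§4 «The functions in (3.53) are analytic on the above spaces» BY COMPOSITION: `analyticAt_pair_lemma4` — for any complex normed parameter
   space `E` (the variables `𝐔, 𝐉, 𝐀, B′`) and letters `e ↦ 𝐊(e)(b)`, `e ↦ 𝐀₂(e)(b)` analytic at `e₀` (the by-reference inputs: `𝐇_j`,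
   the gauge transformations and `𝐀₂` are analytic functions of their arguments, [15] and p. 276), the printed pair
   `e ↦ (exp iξ(𝐊(e) + 𝐀₂(e)), J(exp iξ(𝐊(e) + 𝐀₂(e))))` is analytic at `e₀` (p05's `B12Eq44Analytic.analyticAt_current` and pv27's
   `B9Eq373V3Analytic.cfgAnalyticAt_prodCfg` BY NAME).
HONEST SCOPE as in `B12CondIIIJConcrete` (global sizes; (3.42), (J2), (J3), (3.38)-data by reference; constants ours); §4 is the
composition step only — the analyticity of `𝐇_j(□₀, ·)`, `u_j`, `𝐀₂` in their arguments is [15]'s (hypotheses `hK`, `hA`).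
Unit `lit-balaban-p07` (Phase-2 seat p07 gen 8; TAKING line HOME/STATUS.md 2026-08-21T18:46:03Z; rows B12.Lem4 / B12.Eq3.36 /
B12.Eq3.37-3.47, owners r09/r20), HOME `run/shared/lean/pub/lit-balaban/`.
-/

noncomputable section

open NormedSpace Complex

namespace Literature.MathematicalPhysics.QuantumFieldTheory.Balaban1983to89.B12CondIIIJConcreteModels

open Literature.MathematicalPhysics.QuantumFieldTheory.Balaban1983to89
open Literature.MathematicalPhysics.QuantumFieldTheory.Balaban1983to89.B9Eq39Adjoint (R)
open Literature.MathematicalPhysics.QuantumFieldTheory.Balaban1983to89.B12Eq311CurrentExpansion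
open Literature.MathematicalPhysics.QuantumFieldTheory.Balaban1983to89.B12Eq311RemainderQuadratic
open Literature.MathematicalPhysics.QuantumFieldTheory.Balaban1983to89.B12RegularSpaces111
open Literature.MathematicalPhysics.QuantumFieldTheory.Balaban1983to89.B12RegularSpaces111Unitary
open Literature.MathematicalPhysics.QuantumFieldTheory.Balaban1983to89.B12RegularSpaces111SpecialUnitary
open Literature.MathematicalPhysics.QuantumFieldTheory.Balaban1983to89.B12Eq18Current
open Literature.MathematicalPhysics.QuantumFieldTheory.Balaban1983to89.B12Lemma4Models
open Literature.MathematicalPhysics.QuantumFieldTheory.Balaban1983to89.B12Eq311Models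
open Literature.MathematicalPhysics.QuantumFieldTheory.Balaban1983to89.B12CondIIIJConcrete

variable {P : Params} {i : ℕ}

/-! ## §1. `π = id`, `Cπ = 1` (the `U(N)`-type model) -/

section Identity

variable {𝔸 : Type*} [NormedRing 𝔸] [NormedAlgebra ℂ 𝔸] [CompleteSpace 𝔸] [NormOneClass 𝔸]

/-- **|𝐉| < α₀ for the Lemma-4 configuration, `π = id`** (`G ⊂ U(N)`-type model: `𝔤ᶜ = 𝔸`, `Cπ = 1`): `B12CondIIIJConcrete.norm_current_lt_alpha0`
with the `π`-hypotheses discharged; the one restriction reads `4·(d−1)·C_F(1)·B²·α₀ ≤ β`. [cite: Balaban1987RG1, p.280 after (3.52)] -/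
theorem norm_current_lt_alpha0_id (c : B12Sec2to5.Lemma4Consts) (hR : B12Sec2to5.Lemma4Restrictions c) (hB : 1 ≤ c.B₃)
    (hY : 1 ≤ c.B₃ ^ 2 * c.O₁ * c.M) {ξ η τ n B₃'' : ℝ} {j : ℕ} {H H₁ K A : PBond P i → 𝔸}
    (hresJ : 4 * ((P.d - 1) * C311 1) * (c.B₃ ^ 2 * c.O₁ * c.M) ^ 2 * c.α₀ ≤ c.β)
    (hres'' : B₃'' * c.α₃ ≤ c.β * c.L⁻¹ ^ 2 * c.α₀)
    (hξ : 0 < ξ) (hξ1 : ξ ≤ 1) (hη : 0 ≤ η) (hj : 1 ≤ j) (hscale : c.L ^ j * η ≤ 1) (hτ0 : 0 ≤ τ) (hτ1 : τ ≤ 1)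
    (hn : n < c.α₃) (hB'' : 0 ≤ B₃'')
    (hHg : ∀ b, ‖H b‖ ≤ c.B₃ ^ 2 * c.O₁ * c.M * c.α₀ * (c.L ^ (j - 1) * η))
    (hHd : ∀ μ ν y, ‖grad ξ μ (fun z => H ⟨z, ν⟩) y‖ ≤ c.B₃ ^ 2 * c.O₁ * c.M * c.α₀ * (c.L ^ (j - 1) * η))
    (hKg : ∀ b, ‖K b‖ ≤ c.B₃ ^ 2 * c.O₁ * c.M * c.α₀ * (c.L ^ (j - 1) * η))
    (hKd : ∀ μ ν y, ‖grad ξ μ (fun z => K ⟨z, ν⟩) y‖ ≤ c.B₃ ^ 2 * c.O₁ * c.M * c.α₀ * (c.L ^ (j - 1) * η))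
    (hAg : ∀ b, ‖A b‖ ≤ c.B₃ * n) (hAd : ∀ μ ν y, ‖grad ξ μ (fun z => A ⟨z, ν⟩) y‖ ≤ c.B₃ * n) (b : PBond P i)
    (h42 : ‖current LinearMap.id ξ (fun b => expI ξ (H b)) b‖ < (1 + 3 * c.β) * c.α₀ * (c.L ^ (j - 1) * η) ^ 3)
    (hS : ‖lapCur LinearMap.id ξ (1 : PBond P i → 𝔸ˣ) (H - H₁) b‖ < c.β * c.α₀ * (c.L ^ (j - 1) * η) ^ 2)
    (hSτ : ‖lapCur LinearMap.id ξ (1 : PBond P i → 𝔸ˣ) (K - (τ : ℂ) • H₁) b‖ < c.β * c.α₀ * (c.L ^ (j - 1) * η) ^ 2)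
    (hA2 : ‖lapCur LinearMap.id ξ (1 : PBond P i → 𝔸ˣ) A b‖ ≤ B₃'' * n) :
    ‖current LinearMap.id ξ (fun b => expI ξ (K b + A b)) b‖ < c.α₀ :=
  norm_current_lt_alpha0 c hR hB hY (Cπ := 1) (by rw [one_mul]; exact hresJ) hres'' hξ hξ1 hη hj hscale hτ0 hτ1 hn hB''
    zero_le_one (fun X => by rw [LinearMap.id_apply, one_mul]) hHg hHd hKg hKd hAg hAd b h42 hS hSτ hA2

variable [StarRing 𝔸]

/-- **Lemma 4 for the printed pair `(𝐔, J(𝐔))` with (iv) derived from (3.38) AND the J-half of (iii) derived, `U(N)`-type model**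
(`G = U(𝔸)`, `Gᶜ = 𝔸ˣ`, `𝔤ᶜ = 𝔸`, `π` the identity): `B12CondIIIJConcrete.ofBackground_mem_space'_lemma4_of_jInputs` with `heGc`, `hπ`, `hgc`,
`hπR`, `hπn` and the `𝔤ᶜ`-valuedness of `𝐊`, `𝐀₂` discharged. [cite: Balaban1987RG1, Lemma 4 (3.53) p.280 with (3.38) p.278 and p.279 after (3.47)] -/
theorem ofBackground_mem_space'_lemma4_of_jInputs_unitary (c : B12Sec2to5.Lemma4Consts) (hR : B12Sec2to5.Lemma4Restrictions c)
    (hB : 1 ≤ c.B₃) (hY : 1 ≤ c.B₃ ^ 2 * c.O₁ * c.M) (hα₁ : 16 * (c.O₁ * c.M * c.α₁) ≤ c.β) (hL10 : 1 + 10 * c.β ≤ c.L ^ 2)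
    {F : Frame P i 𝔸} {cs : StepConsts} (hξ : 0 < cs.ξ) (hξ1 : cs.ξ ≤ 1) (hcB : 0 < cs.cB)
    (hL : 1 ≤ cs.L) (hLξ : cs.L ^ cs.j * cs.ξ = 1)
    {η τ n B₃'' : ℝ} {j : ℕ} (hη : 0 ≤ η) (hj : 1 ≤ j) (hscale : c.L ^ j * η ≤ 1)
    (hξx : cs.ξ * (c.L ^ (j - 1) * η) = c.L⁻¹ * η) (hτ0 : 0 ≤ τ) (hτ1 : τ ≤ 1) (hn : n < c.α₃) (hB'' : 0 ≤ B₃'')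
    (hres'' : B₃'' * c.α₃ ≤ c.β * c.L⁻¹ ^ 2 * c.α₀)
    (hresJ : 4 * ((P.d - 1) * C311 1) * (c.B₃ ^ 2 * c.O₁ * c.M) ^ 2 * c.α₀ ≤ c.β)
    {Y : Region P i} (hXb : F.X.bonds ⊆ Y.bonds) (hXd : F.X.dpairs ⊆ Y.dpairs) (hX₂b : F.X₂.bonds ⊆ Y.bonds)
    (hX₂p : F.X₂.plaqs ⊆ F.X.plaqs)
    (hXp : ∀ p ∈ F.X.plaqs, (⟨p.src, p.μ⟩ : PBond P i) ∈ Y.bonds ∧ (⟨p.src.shift p.μ, p.ν⟩ : PBond P i) ∈ Y.bonds ∧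
      (⟨p.src.shift p.ν, p.μ⟩ : PBond P i) ∈ Y.bonds ∧ (⟨p.src, p.ν⟩ : PBond P i) ∈ Y.bonds ∧
      (p.src, p.μ, p.ν) ∈ Y.dpairs ∧ (p.src, p.ν, p.μ) ∈ Y.dpairs)
    {H H₁ K A : PBond P i → 𝔸} {ℓ : Plaq P i → 𝔸}
    (h41 : ∀ p ∈ F.X.plaqs, ‖((plaq (fun b => expI cs.ξ (H b)) p : 𝔸ˣ) : 𝔸) - 1‖ <
      Real.exp (c.B₃ ^ 2 * c.O₁ * c.M * c.α₀) * Real.exp (c.B₃ * c.O₁ * c.M * c.α₀) *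
      Real.exp (c.B₃ * c.O₁ * c.M * c.α₀) * Real.exp (c.O₁ * c.M * c.α₁) *
      ((1 + 2 * c.β) * c.α₀ * (c.L⁻¹ * η) ^ 2))
    (hH : ∀ b, ‖H b‖ < c.B₃ ^ 2 * c.O₁ * c.M * c.α₀ * (c.L ^ (j - 1) * η))
    (hHd : ∀ μ ν y, ‖grad cs.ξ μ (fun z => H ⟨z, ν⟩) y‖ < c.B₃ ^ 2 * c.O₁ * c.M * c.α₀ * (c.L ^ (j - 1) * η))
    (h45 : ∀ p ∈ F.X.plaqs, ‖(cs.ξ : ℂ)⁻¹ • (H ⟨p.src, p.μ⟩ + H ⟨p.src.shift p.μ, p.ν⟩ - H ⟨p.src.shift p.ν, p.μ⟩ -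
      H ⟨p.src, p.ν⟩) - ℓ p‖ < c.B₃ * (c.B₃ * c.O₁ * c.M * c.α₀ * (c.L ^ (j - 1) * η)) ^ 2)
    (hK : ∀ b, ‖K b‖ < c.B₃ ^ 2 * c.O₁ * c.M * c.α₀ * (c.L ^ (j - 1) * η))
    (hKd : ∀ μ ν y, ‖grad cs.ξ μ (fun z => K ⟨z, ν⟩) y‖ < c.B₃ ^ 2 * c.O₁ * c.M * c.α₀ * (c.L ^ (j - 1) * η))
    (h45τ : ∀ p ∈ F.X.plaqs, ‖(cs.ξ : ℂ)⁻¹ • (K ⟨p.src, p.μ⟩ + K ⟨p.src.shift p.μ, p.ν⟩ - K ⟨p.src.shift p.ν, p.μ⟩ -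
      K ⟨p.src, p.ν⟩) - (τ : ℂ) • ℓ p‖ < c.B₃ * (c.B₃ * c.O₁ * c.M * c.α₀ * (c.L ^ (j - 1) * η)) ^ 2)
    (hA : ∀ b, ‖A b‖ ≤ c.B₃ * n) (hAd : ∀ μ ν y, ‖grad cs.ξ μ (fun z => A ⟨z, ν⟩) y‖ ≤ c.B₃ * n)
    (h42 : ∀ b ∈ Y.bonds,
      ‖current LinearMap.id cs.ξ (fun b => expI cs.ξ (H b)) b‖ < (1 + 3 * c.β) * c.α₀ * (c.L ^ (j - 1) * η) ^ 3)
    (hS : ∀ b ∈ Y.bonds,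
      ‖lapCur LinearMap.id cs.ξ (1 : PBond P i → 𝔸ˣ) (H - H₁) b‖ < c.β * c.α₀ * (c.L ^ (j - 1) * η) ^ 2)
    (hSτ : ∀ b ∈ Y.bonds,
      ‖lapCur LinearMap.id cs.ξ (1 : PBond P i → 𝔸ˣ) (K - (τ : ℂ) • H₁) b‖ < c.β * c.α₀ * (c.L ^ (j - 1) * η) ^ 2)
    (hA2 : ∀ b ∈ Y.bonds, ‖lapCur LinearMap.id cs.ξ (1 : PBond P i → 𝔸ˣ) A b‖ ≤ B₃'' * n)
    {uj : Site P i → 𝔸ˣ} {ubar w₁ : ℕ → Site P i → 𝔸ˣ} {ctr : ℕ → Site P i → Site P i}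
    (huj : ∀ y, ‖(uj y : 𝔸)‖ * ‖(↑(uj y)⁻¹ : 𝔸)‖ ≤ Real.exp (c.B₃ ^ 2 * c.O₁ * c.M * c.α₀))
    (hubar : ∀ n x, ubar n x = uj (ctr n x))
    (h338 : ∀ m, 1 ≤ m → m ≤ cs.j → ∀ p ∈ F.X₂.plaqs, plaq (F.bg.Un m (fun b => expI cs.ξ (K b + A b))) p =
      plaq (gaugeU (uj * (ubar m)⁻¹) (fun b => expI cs.ξ (K b + A b))) p)
    (hJn : ∀ m, 1 ≤ m → m ≤ cs.j → ∀ b ∈ F.X₂.bonds, F.bg.Jn m (fun b => expI cs.ξ (K b + A b)) b =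
      current LinearMap.id (cs.L ^ m)⁻¹ (gaugeU (uj * (ubar m)⁻¹) (fun b => expI cs.ξ (K b + A b))) b)
    (h338₁ : ∀ m, 1 ≤ m → m ≤ cs.j → ∀ p ∈ F.X₂.plaqs,
      plaq (F.bg.Un m (1 : PBond P i → 𝔸ˣ)) p = plaq (gaugeU (w₁ m) (1 : PBond P i → 𝔸ˣ)) p)
    (hJn₁ : ∀ m, 1 ≤ m → m ≤ cs.j → ∀ b ∈ F.X₂.bonds,
      F.bg.Jn m (1 : PBond P i → 𝔸ˣ) b = current LinearMap.id (cs.L ^ m)⁻¹ (gaugeU (w₁ m) (1 : PBond P i → 𝔸ˣ)) b) :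
    ofBackground LinearMap.id cs.ξ (fun b => expI cs.ξ (K b + A b)) ∈ space' (unitaryModel 𝔸) F cs c.α₀ c.α₁ :=
  ofBackground_mem_space'_lemma4_of_jInputs (unitaryModel 𝔸) c hR hB hY hα₁ hL10 hξ hξ1 hcB hL hLξ hη hj hscale hξx hτ0 hτ1 hn hB''
    hres'' (Cπ := 1) (by rw [one_mul]; exact hresJ) (unitaryModel_heGc cs.ξ) LinearMap.id (unitaryModel_hπ LinearMap.id)
    unitaryModel_hgc_Gc (fun _ _ => rfl) zero_le_one (fun X => by rw [LinearMap.id_apply, one_mul]) hXb hXd hX₂b hX₂p hXp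
    (fun _ => mem_unitaryModel_gc _) (fun _ => mem_unitaryModel_gc _) h41 hH hHd h45 hK hKd h45τ hA hAd h42 hS hSτ hA2 huj hubar
    h338 hJn h338₁ hJn₁

end Identity

/-! ## §2. `π = slProj N`, `Cπ = 2` (the `SU(N)` model; operator norms on `M_N(ℂ)`) -/

section SpecialUnitary

open scoped Matrix.Norms.L2Operator

variable {N : ℕ} [NeZero N]

/-- **|𝐉| < α₀ for the Lemma-4 configuration, `SU(N)` model** (`𝔤ᶜ = 𝔰𝔩(N, ℂ)`, `π = slProj N` of operator norm `≤ 2`,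
`B12Eq311Models.norm_slProj_le`; `N ≠ 0`): `B12CondIIIJConcrete.norm_current_lt_alpha0` with `Cπ = 2`; the one restriction reads
`4·(d−1)·2C_F(1)·B²·α₀ ≤ β`. [cite: Balaban1987RG1, p.280 after (3.52)] -/
theorem norm_current_lt_alpha0_su (c : B12Sec2to5.Lemma4Consts) (hR : B12Sec2to5.Lemma4Restrictions c) (hB : 1 ≤ c.B₃)
    (hY : 1 ≤ c.B₃ ^ 2 * c.O₁ * c.M) {ξ η τ n B₃'' : ℝ} {j : ℕ} {H H₁ K A : PBond P i → Matrix (Fin N) (Fin N) ℂ}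
    (hresJ : 4 * ((P.d - 1) * (2 * C311 1)) * (c.B₃ ^ 2 * c.O₁ * c.M) ^ 2 * c.α₀ ≤ c.β)
    (hres'' : B₃'' * c.α₃ ≤ c.β * c.L⁻¹ ^ 2 * c.α₀)
    (hξ : 0 < ξ) (hξ1 : ξ ≤ 1) (hη : 0 ≤ η) (hj : 1 ≤ j) (hscale : c.L ^ j * η ≤ 1) (hτ0 : 0 ≤ τ) (hτ1 : τ ≤ 1)
    (hn : n < c.α₃) (hB'' : 0 ≤ B₃'')
    (hHg : ∀ b, ‖H b‖ ≤ c.B₃ ^ 2 * c.O₁ * c.M * c.α₀ * (c.L ^ (j - 1) * η))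
    (hHd : ∀ μ ν y, ‖grad ξ μ (fun z => H ⟨z, ν⟩) y‖ ≤ c.B₃ ^ 2 * c.O₁ * c.M * c.α₀ * (c.L ^ (j - 1) * η))
    (hKg : ∀ b, ‖K b‖ ≤ c.B₃ ^ 2 * c.O₁ * c.M * c.α₀ * (c.L ^ (j - 1) * η))
    (hKd : ∀ μ ν y, ‖grad ξ μ (fun z => K ⟨z, ν⟩) y‖ ≤ c.B₃ ^ 2 * c.O₁ * c.M * c.α₀ * (c.L ^ (j - 1) * η))
    (hAg : ∀ b, ‖A b‖ ≤ c.B₃ * n) (hAd : ∀ μ ν y, ‖grad ξ μ (fun z => A ⟨z, ν⟩) y‖ ≤ c.B₃ * n) (b : PBond P i)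
    (h42 : ‖current (slProj N) ξ (fun b => expI ξ (H b)) b‖ < (1 + 3 * c.β) * c.α₀ * (c.L ^ (j - 1) * η) ^ 3)
    (hS : ‖lapCur (slProj N) ξ (1 : PBond P i → (Matrix (Fin N) (Fin N) ℂ)ˣ) (H - H₁) b‖
      < c.β * c.α₀ * (c.L ^ (j - 1) * η) ^ 2)
    (hSτ : ‖lapCur (slProj N) ξ (1 : PBond P i → (Matrix (Fin N) (Fin N) ℂ)ˣ) (K - (τ : ℂ) • H₁) b‖
      < c.β * c.α₀ * (c.L ^ (j - 1) * η) ^ 2)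
    (hA2 : ‖lapCur (slProj N) ξ (1 : PBond P i → (Matrix (Fin N) (Fin N) ℂ)ˣ) A b‖ ≤ B₃'' * n) :
    ‖current (slProj N) ξ (fun b => expI ξ (K b + A b)) b‖ < c.α₀ :=
  norm_current_lt_alpha0 c hR hB hY hresJ hres'' hξ hξ1 hη hj hscale hτ0 hτ1 hn hB'' zero_le_two norm_slProj_le hHg hHd
    hKg hKd hAg hAd b h42 hS hSτ hA2

/-- **Lemma 4 for the printed pair `(𝐔, J(𝐔))` with (iv) derived from (3.38) AND the J-half of (iii) derived, `SU(N)` model** (`G = SU(N)`,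
`Gᶜ = SL(N, ℂ)`, `𝔤ᶜ = 𝔰𝔩(N, ℂ)`, `π = slProj N`, `N ≠ 0`): `B12CondIIIJConcrete.ofBackground_mem_space'_lemma4_of_jInputs` with `heGc`
(`suModel_heGc`), `hπ` (`slProj_mem_suModel_gc`), `hgc` (`suModel_hgc_Gc`), `hπR` (`slProj_conj`), `hπn` (`norm_slProj_le`, `Cπ = 2`) discharged;
`𝐊`, `𝐀₂` traceless. [cite: Balaban1987RG1, Lemma 4 (3.53) p.280 with (3.38) p.278 and p.279 after (3.47)] -/
theorem ofBackground_mem_space'_lemma4_of_jInputs_su (c : B12Sec2to5.Lemma4Consts) (hR : B12Sec2to5.Lemma4Restrictions c)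
    (hB : 1 ≤ c.B₃) (hY : 1 ≤ c.B₃ ^ 2 * c.O₁ * c.M) (hα₁ : 16 * (c.O₁ * c.M * c.α₁) ≤ c.β) (hL10 : 1 + 10 * c.β ≤ c.L ^ 2)
    {F : Frame P i (Matrix (Fin N) (Fin N) ℂ)} {cs : StepConsts} (hξ : 0 < cs.ξ) (hξ1 : cs.ξ ≤ 1) (hcB : 0 < cs.cB)
    (hL : 1 ≤ cs.L) (hLξ : cs.L ^ cs.j * cs.ξ = 1)
    {η τ n B₃'' : ℝ} {j : ℕ} (hη : 0 ≤ η) (hj : 1 ≤ j) (hscale : c.L ^ j * η ≤ 1)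
    (hξx : cs.ξ * (c.L ^ (j - 1) * η) = c.L⁻¹ * η) (hτ0 : 0 ≤ τ) (hτ1 : τ ≤ 1) (hn : n < c.α₃) (hB'' : 0 ≤ B₃'')
    (hres'' : B₃'' * c.α₃ ≤ c.β * c.L⁻¹ ^ 2 * c.α₀)
    (hresJ : 4 * ((P.d - 1) * (2 * C311 1)) * (c.B₃ ^ 2 * c.O₁ * c.M) ^ 2 * c.α₀ ≤ c.β)
    {Y : Region P i} (hXb : F.X.bonds ⊆ Y.bonds) (hXd : F.X.dpairs ⊆ Y.dpairs) (hX₂b : F.X₂.bonds ⊆ Y.bonds)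
    (hX₂p : F.X₂.plaqs ⊆ F.X.plaqs)
    (hXp : ∀ p ∈ F.X.plaqs, (⟨p.src, p.μ⟩ : PBond P i) ∈ Y.bonds ∧ (⟨p.src.shift p.μ, p.ν⟩ : PBond P i) ∈ Y.bonds ∧
      (⟨p.src.shift p.ν, p.μ⟩ : PBond P i) ∈ Y.bonds ∧ (⟨p.src, p.ν⟩ : PBond P i) ∈ Y.bonds ∧
      (p.src, p.μ, p.ν) ∈ Y.dpairs ∧ (p.src, p.ν, p.μ) ∈ Y.dpairs)
    {H H₁ K A : PBond P i → Matrix (Fin N) (Fin N) ℂ} {ℓ : Plaq P i → Matrix (Fin N) (Fin N) ℂ}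
    (hKtr : ∀ b, (K b).trace = 0) (hAtr : ∀ b, (A b).trace = 0)
    (h41 : ∀ p ∈ F.X.plaqs, ‖((plaq (fun b => expI cs.ξ (H b)) p : (Matrix (Fin N) (Fin N) ℂ)ˣ) : Matrix (Fin N) (Fin N) ℂ) - 1‖ <
      Real.exp (c.B₃ ^ 2 * c.O₁ * c.M * c.α₀) * Real.exp (c.B₃ * c.O₁ * c.M * c.α₀) *
      Real.exp (c.B₃ * c.O₁ * c.M * c.α₀) * Real.exp (c.O₁ * c.M * c.α₁) *
      ((1 + 2 * c.β) * c.α₀ * (c.L⁻¹ * η) ^ 2))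
    (hH : ∀ b, ‖H b‖ < c.B₃ ^ 2 * c.O₁ * c.M * c.α₀ * (c.L ^ (j - 1) * η))
    (hHd : ∀ μ ν y, ‖grad cs.ξ μ (fun z => H ⟨z, ν⟩) y‖ < c.B₃ ^ 2 * c.O₁ * c.M * c.α₀ * (c.L ^ (j - 1) * η))
    (h45 : ∀ p ∈ F.X.plaqs, ‖(cs.ξ : ℂ)⁻¹ • (H ⟨p.src, p.μ⟩ + H ⟨p.src.shift p.μ, p.ν⟩ - H ⟨p.src.shift p.ν, p.μ⟩ -
      H ⟨p.src, p.ν⟩) - ℓ p‖ < c.B₃ * (c.B₃ * c.O₁ * c.M * c.α₀ * (c.L ^ (j - 1) * η)) ^ 2)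
    (hK : ∀ b, ‖K b‖ < c.B₃ ^ 2 * c.O₁ * c.M * c.α₀ * (c.L ^ (j - 1) * η))
    (hKd : ∀ μ ν y, ‖grad cs.ξ μ (fun z => K ⟨z, ν⟩) y‖ < c.B₃ ^ 2 * c.O₁ * c.M * c.α₀ * (c.L ^ (j - 1) * η))
    (h45τ : ∀ p ∈ F.X.plaqs, ‖(cs.ξ : ℂ)⁻¹ • (K ⟨p.src, p.μ⟩ + K ⟨p.src.shift p.μ, p.ν⟩ - K ⟨p.src.shift p.ν, p.μ⟩ -
      K ⟨p.src, p.ν⟩) - (τ : ℂ) • ℓ p‖ < c.B₃ * (c.B₃ * c.O₁ * c.M * c.α₀ * (c.L ^ (j - 1) * η)) ^ 2)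
    (hA : ∀ b, ‖A b‖ ≤ c.B₃ * n) (hAd : ∀ μ ν y, ‖grad cs.ξ μ (fun z => A ⟨z, ν⟩) y‖ ≤ c.B₃ * n)
    (h42 : ∀ b ∈ Y.bonds,
      ‖current (slProj N) cs.ξ (fun b => expI cs.ξ (H b)) b‖ < (1 + 3 * c.β) * c.α₀ * (c.L ^ (j - 1) * η) ^ 3)
    (hS : ∀ b ∈ Y.bonds, ‖lapCur (slProj N) cs.ξ (1 : PBond P i → (Matrix (Fin N) (Fin N) ℂ)ˣ) (H - H₁) b‖
      < c.β * c.α₀ * (c.L ^ (j - 1) * η) ^ 2)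
    (hSτ : ∀ b ∈ Y.bonds, ‖lapCur (slProj N) cs.ξ (1 : PBond P i → (Matrix (Fin N) (Fin N) ℂ)ˣ) (K - (τ : ℂ) • H₁) b‖
      < c.β * c.α₀ * (c.L ^ (j - 1) * η) ^ 2)
    (hA2 : ∀ b ∈ Y.bonds, ‖lapCur (slProj N) cs.ξ (1 : PBond P i → (Matrix (Fin N) (Fin N) ℂ)ˣ) A b‖ ≤ B₃'' * n)
    {uj : Site P i → (Matrix (Fin N) (Fin N) ℂ)ˣ} {ubar w₁ : ℕ → Site P i → (Matrix (Fin N) (Fin N) ℂ)ˣ}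
    {ctr : ℕ → Site P i → Site P i}
    (huj : ∀ y, ‖(uj y : Matrix (Fin N) (Fin N) ℂ)‖ * ‖(↑(uj y)⁻¹ : Matrix (Fin N) (Fin N) ℂ)‖ ≤ Real.exp (c.B₃ ^ 2 * c.O₁ * c.M * c.α₀))
    (hubar : ∀ n x, ubar n x = uj (ctr n x))
    (h338 : ∀ m, 1 ≤ m → m ≤ cs.j → ∀ p ∈ F.X₂.plaqs, plaq (F.bg.Un m (fun b => expI cs.ξ (K b + A b))) p =
      plaq (gaugeU (uj * (ubar m)⁻¹) (fun b => expI cs.ξ (K b + A b))) p)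
    (hJn : ∀ m, 1 ≤ m → m ≤ cs.j → ∀ b ∈ F.X₂.bonds, F.bg.Jn m (fun b => expI cs.ξ (K b + A b)) b =
      current (slProj N) (cs.L ^ m)⁻¹ (gaugeU (uj * (ubar m)⁻¹) (fun b => expI cs.ξ (K b + A b))) b)
    (h338₁ : ∀ m, 1 ≤ m → m ≤ cs.j → ∀ p ∈ F.X₂.plaqs, plaq (F.bg.Un m (1 : PBond P i → (Matrix (Fin N) (Fin N) ℂ)ˣ)) p =
      plaq (gaugeU (w₁ m) (1 : PBond P i → (Matrix (Fin N) (Fin N) ℂ)ˣ)) p)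
    (hJn₁ : ∀ m, 1 ≤ m → m ≤ cs.j → ∀ b ∈ F.X₂.bonds, F.bg.Jn m (1 : PBond P i → (Matrix (Fin N) (Fin N) ℂ)ˣ) b =
      current (slProj N) (cs.L ^ m)⁻¹ (gaugeU (w₁ m) (1 : PBond P i → (Matrix (Fin N) (Fin N) ℂ)ˣ)) b) :
    ofBackground (slProj N) cs.ξ (fun b => expI cs.ξ (K b + A b)) ∈ space' (suModel N) F cs c.α₀ c.α₁ :=
  ofBackground_mem_space'_lemma4_of_jInputs (suModel N) c hR hB hY hα₁ hL10 hξ hξ1 hcB hL hLξ hη hj hscale hξx hτ0 hτ1 hn hB''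
    hres'' hresJ (suModel_heGc cs.ξ) (slProj N) slProj_mem_suModel_gc suModel_hgc_Gc (fun g X => slProj_conj g X) zero_le_two
    norm_slProj_le hXb hXd hX₂b hX₂p hXp (fun b => mem_suModel_gc.2 (hKtr b)) (fun b => mem_suModel_gc.2 (hAtr b)) h41 hH hHd h45
    hK hKd h45τ hA hAd h42 hS hSτ hA2 huj hubar h338 hJn h338₁ hJn₁

end SpecialUnitary

/-! ## §3. (3.36): the case `B′ = 0` -/

section Eq336

variable {𝔸 : Type*} [NormedRing 𝔸] [NormedAlgebra ℂ 𝔸] [CompleteSpace 𝔸] [NormOneClass 𝔸]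

omit [CompleteSpace 𝔸] [NormOneClass 𝔸] in
/-- `∂^{ξ*}π∂^ξ 0 = 0`. [cite: Balaban1987RG1, (3.11) p.272] -/
theorem lapCur_zero (π : 𝔸 →ₗ[ℂ] 𝔸) (ξ : ℝ) (U : PBond P i → 𝔸ˣ) (b : PBond P i) :
    lapCur π ξ U (0 : PBond P i → 𝔸) b = 0 := by
  have h := lapCur_smul π ξ U (0 : ℂ) (0 : PBond P i → 𝔸) b
  rwa [zero_smul, zero_smul] at h

/-- **The J-half of (iii) for (3.36)** — the Lemma-4 configuration at `B′ = 0` («We have to prove that (U_j(□₀, exp iτB), J_j(□₀, exp iτB))|_X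
∈ U^c_j(X, α₀, α₁) (3.36) … for the parameters τ in the interval [0, 1]»): for `𝐊 = 𝐇_j(□₀, τQ(…))` with the (3.37) sizes, the PRINTED
(3.42) at the bond and the (3.45)-analogues (J2) at `Q` and `τQ`, under «all the restrictions» + the one restriction `4·C_J·B²·α₀ ≤ β`:
`|𝐉(exp iξ𝐊)(b)| < α₀` (`B12CondIIIJConcrete.norm_current_lt_alpha0` at `𝐀₂ = 0`, `B₃″ = 0`). [cite: Balaban1987RG1, (3.36) p.277] -/
theorem norm_current_lt_alpha0_eq336 (c : B12Sec2to5.Lemma4Consts) (hR : B12Sec2to5.Lemma4Restrictions c) (hB : 1 ≤ c.B₃)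
    (hY : 1 ≤ c.B₃ ^ 2 * c.O₁ * c.M) {ξ Cπ η τ : ℝ} {j : ℕ} {π : 𝔸 →ₗ[ℂ] 𝔸} {H H₁ K : PBond P i → 𝔸}
    (hresJ : 4 * ((P.d - 1) * (Cπ * C311 1)) * (c.B₃ ^ 2 * c.O₁ * c.M) ^ 2 * c.α₀ ≤ c.β)
    (hξ : 0 < ξ) (hξ1 : ξ ≤ 1) (hη : 0 ≤ η) (hj : 1 ≤ j) (hscale : c.L ^ j * η ≤ 1) (hτ0 : 0 ≤ τ) (hτ1 : τ ≤ 1)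
    (hCπ : 0 ≤ Cπ) (hπn : ∀ X, ‖π X‖ ≤ Cπ * ‖X‖)
    (hHg : ∀ b, ‖H b‖ ≤ c.B₃ ^ 2 * c.O₁ * c.M * c.α₀ * (c.L ^ (j - 1) * η))
    (hHd : ∀ μ ν y, ‖grad ξ μ (fun z => H ⟨z, ν⟩) y‖ ≤ c.B₃ ^ 2 * c.O₁ * c.M * c.α₀ * (c.L ^ (j - 1) * η))
    (hKg : ∀ b, ‖K b‖ ≤ c.B₃ ^ 2 * c.O₁ * c.M * c.α₀ * (c.L ^ (j - 1) * η))
    (hKd : ∀ μ ν y, ‖grad ξ μ (fun z => K ⟨z, ν⟩) y‖ ≤ c.B₃ ^ 2 * c.O₁ * c.M * c.α₀ * (c.L ^ (j - 1) * η)) (b : PBond P i)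
    (h42 : ‖current π ξ (fun b => expI ξ (H b)) b‖ < (1 + 3 * c.β) * c.α₀ * (c.L ^ (j - 1) * η) ^ 3)
    (hS : ‖lapCur π ξ (1 : PBond P i → 𝔸ˣ) (H - H₁) b‖ < c.β * c.α₀ * (c.L ^ (j - 1) * η) ^ 2)
    (hSτ : ‖lapCur π ξ (1 : PBond P i → 𝔸ˣ) (K - (τ : ℂ) • H₁) b‖ < c.β * c.α₀ * (c.L ^ (j - 1) * η) ^ 2) :
    ‖current π ξ (fun b => expI ξ (K b)) b‖ < c.α₀ := by
  have hR' := hR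
  unfold B12Sec2to5.Lemma4Restrictions at hR'
  obtain ⟨hα₀, _, _, hα₃, hβ, _, _, _, _, _, _, _, _, _⟩ := hR'
  have hres'' : (0 : ℝ) * c.α₃ ≤ c.β * c.L⁻¹ ^ 2 * c.α₀ := by
    rw [zero_mul]; exact mul_nonneg (mul_nonneg hβ.le (sq_nonneg _)) hα₀.le
  have hgrad0 : ∀ (μ ν : Fin P.d) (y : Site P i), ‖grad ξ μ (fun z => (0 : PBond P i → 𝔸) ⟨z, ν⟩) y‖ ≤ c.B₃ * 0 := fun μ ν y => by
    simp [grad]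
  have h := norm_current_lt_alpha0 c hR hB hY (A := 0) (n := 0) (B₃'' := 0) hresJ hres'' hξ hξ1 hη hj hscale hτ0 hτ1 hα₃ le_rfl
    hCπ hπn hHg hHd hKg hKd (fun b => by simp) hgrad0 b h42 hS hSτ (by rw [lapCur_zero, norm_zero, zero_mul])
  simpa only [Pi.zero_apply, add_zero] using h

end Eq336

/-! ## §4. «The functions in (3.53) are analytic on the above spaces» — the composition step -/

section Analytic

open B9Eq373V3Analytic B12Eq44Analytic

variable {𝔸 : Type*} [NormedRing 𝔸] [NormedAlgebra ℂ 𝔸] [CompleteSpace 𝔸]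
variable {E : Type*} [NormedAddCommGroup E] [NormedSpace ℂ E]

/-- **Lemma 4, last sentence, by composition** («The functions in (3.53) are analytic on the above spaces»; p. 276 «these gauge
transformations are explicitly given analytic functions of 𝐔»): over any complex normed parameter space `E` (the variables `𝐔, 𝐉, 𝐀, B′`),
if every letter `e ↦ 𝐊(e)(b′)` and `e ↦ 𝐀₂(e)(b′)` is analytic at `e₀` (the inputs `𝐇_j(□₀, ·)`, `𝐀₂` of [15]), then the printed pair
`e ↦ (exp iξ(𝐊(e) + 𝐀₂(e)), J(exp iξ(𝐊(e) + 𝐀₂(e))))` — bond values and the current (1.8) — is analytic at `e₀`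
(`B9Eq373V3Analytic.cfgAnalyticAt_prodCfg` + `B12Eq44Analytic.analyticAt_current` BY NAME). [cite: Balaban1987RG1, Lemma 4 p.280] -/
theorem analyticAt_pair_lemma4 {π : 𝔸 →ₗ[ℂ] 𝔸} {Cπ : ℝ} (hπn : ∀ X, ‖π X‖ ≤ Cπ * ‖X‖) (ξ : ℝ)
    {K A : E → PBond P i → 𝔸} {e₀ : E} (hK : ∀ b, AnalyticAt ℂ (fun e => K e b) e₀) (hA : ∀ b, AnalyticAt ℂ (fun e => A e b) e₀) :
    AnalyticAt ℂ (fun e : E =>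
      ((fun b => ((ofBackground π ξ (fun b => expI ξ (K e b + A e b))).U b : 𝔸)),
        (ofBackground π ξ (fun b => expI ξ (K e b + A e b))).J)) e₀ := by
  have hcfg : CfgAnalyticAt (fun e => dirForm (sub310 ξ (K e + A e) (1 : PBond P i → 𝔸ˣ))) e₀ := by
    simp only [dirForm_sub310]
    exact cfgAnalyticAt_prodCfg (dirForm (1 : PBond P i → 𝔸ˣ)) ξ (𝒜 := fun e => dirForm (K e + A e))
      (fun κ z => (hK ⟨z, κ⟩).add (hA ⟨z, κ⟩))
  have hfun : ∀ e, (fun b => expI ξ (K e b + A e b)) = sub310 ξ (K e + A e) (1 : PBond P i → 𝔸ˣ) := fun e =>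
    expI_eq_sub310_one ξ (K e + A e)
  simp only [hfun]
  refine AnalyticAt.prod ?_ ?_
  · exact AnalyticAt.pi fun b => hcfg b.dir b.src
  · exact AnalyticAt.pi fun b => analyticAt_current hπn ξ hcfg b

end Analytic

end Literature.MathematicalPhysics.QuantumFieldTheory.Balaban1983to89.B12CondIIIJConcreteModels
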